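import Literature.NumberTheory.LFunctions.KMVMomentAsymptoticsUniqueness
import Literature.NumberTheory.LFunctions.KMVDiagOnlyImpliesValueCrux
import HarnessLib

/-!
# Diagonal-only ON AVERAGE over the good primes of dyadic blocks pins the extra main terms of the
KMV moment asymptotics to `0`, and gives the VALUE crux of the family route
(Kowalski–Michel–VanderKam 2000, §6 p. 19: the two moment displays; Thm. 6.1 / §7: `P = X²`)

Topic `Literature/NumberTheory/LFunctions` (cell landau-siegel §D, knife edge fam; crux K_B =
`BeyondDiagonalBeatsQuarter` of route `PrimeLevelFamEdge`, stmt-Parity-20055). TYPED FROM the §D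
crux idea card `good-primes-table-squeeze` (ls-knife-len-idea-1 g5, REPAIR-SEARCH round 1; sketch
`knife/len/Sketch-g5.lean` sha16 bfacd1bdc8af33f8): the card's OBJECTS verbatim (`mainScale`,
`linScale`, `secondDefect`, `firstDefect`, `goodPrimes`, the predicate `PrimeAveragedDiagOnly a b`),
re-namespaced to `…LFunctions.KMV2000`, and the card's FIRST LEMMA («the squeeze», `C⁺ ⇒ K_B`)
PROVED in the KMV vocabulary. 0 named facts.

WHAT IS DEFINED (predicates with parameters, like `KMV2000.MomentAsymptotics`; nothing asserted):
`mainScale q Δ' = 2ζ(2)² q̂/(Δ'² log² q̂)` and `linScale q Δ' = ζ(2) q̂^{1/2}/(Δ' log q̂)` (the prefactors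
of the two displays of [KowalskiMichelVanderKam2000, §6 p. 19]); `secondDefect P Q Δ' q =
‖Q^h(P,Q) − mainScale·secondMomentForm‖/‖mainScale‖` and `firstDefect` likewise — the RELATIVE
defects from the DIAGONAL-ONLY main terms at level `q`, mollifier length `q̂^{Δ'}` (junk `0` at
`q = 0`); `goodPrimes Δ' N` = primes `q ∈ (N, 2N]` with `q̂(q)^{Δ'} ∉ ℕ` (KMV's proviso `M ∉ ℤ`, §2
p. 7); `PrimeAveragedDiagOnly a b` = the card's `C⁺`: on `(a, b)`, `∀ ε > 0`, eventually in `N`,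
`Σ_{q ∈ goodPrimes Δ' N} (firstDefect + secondDefect) ≤ ε · #goodPrimes Δ' N`. STATUS of `C⁺`: NOT IN
PRINT on any window reaching `Δ' ≥ 1` (registry famE-02); (A)-SENSITIVE per the card (its atom is a
prime-bias statement modulo an exceptional conductor); card graded VARIANT (ls-knife-crit-1 g6,
2026-08-27T09:46:24Z). A definition, never a claim.

WHAT IS PROVED: `exists_goodPrimes_nonempty` (good primes unbounded ⇒ blocks `(N, 2N]` holding one
exist for unboundedly many `N`); `abs_T₂_sub_le_secondDefect` / `abs_T₁_sub_le_firstDefect` (under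
`MomentAsymptotics`, at every good prime past a threshold the defect is `≥ |T| − C/log q̂`, since
`O(q̂ log⁻³ q̂)/‖mainScale‖ = O(1/log q̂)`); THE SQUEEZE `T₂_eq_zero_of_primeAveragedDiagOnly` /
`T₁_eq_zero_of_primeAveragedDiagOnly` (`MomentAsymptotics Δlo Δhi T₁ T₂ ∧ PrimeAveragedDiagOnly a b ⇒
T₁ = T₂ = 0` on `(Δlo, Δhi] ∩ (a, b) ∩ (0, 2]`: an `ε`-average of terms `≥ |T| − ε` over a NON-EMPTY
block forces `|T| ≤ 2ε`; blocks are non-empty for unboundedly many `N` by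
`goodPrimesUnbounded_of_lt_two` / `_two`); and the card's first lemma
`beatsQuarter_ab_of_primeAveragedDiagOnly`: `PrimeAveragedDiagOnly a b`, `a ≤ 1 < b` ⇒ for every
window `(1, Δ]` and every MA-consistent `(T₁, T₂)`, `P = X²` has Cauchy–Schwarz value `> ¼` on
`(1, min Δ (min b 2))` — literally the `(a, b)`-shape of the route's crux `BeyondDiagonalBeatsQuarter`
(rev 1, conjunct `a < 3/2`), via `ratio_one_X_sq` and `quarter_lt_envelope'`.

WHAT THIS IS NOT: no claim that `PrimeAveragedDiagOnly a b` holds on any window, about moments beyond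
the diagonal, E*-fam, or Landau–Siegel zeros; a REDUCTION (`C⁺ ⇒ K_B`), it eliminates nothing. «The
programme SEARCHES and TYPES; no claim about Landau–Siegel zeros, Theorems 1–2 of arXiv:2211.02515
or a repaired Margin232 until a kernel theorem says so.»

## References

* [KowalskiMichelVanderKam2000] E. Kowalski, P. Michel, J. VanderKam, J. reine angew. Math. 526
  (2000) 1–34: §1 p. 1 (`q̂`), §2 p. 7 (`M ∉ ℤ`), §6 p. 19 (the two displays), Thm. 6.1 (32), §7
  p. 21 (`P = X²`). [held: paper:doi-10-1515-crll-2000-074 p0001, p0007, p0019–p0021]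
-/

noncomputable section

namespace Literature.NumberTheory.LFunctions.KMV2000

open Polynomial Finset
open scoped Real

/-! ## The card's objects (verbatim from the sketch, re-namespaced) -/

/-- KMV's main scale `2 ζ(2)² q̂ / (Δ'² log² q̂)` of the mollified second moment (prefactor of the
second display of §6 p. 19; junk value `0` at `q = 0`).
[cite: KowalskiMichelVanderKam2000, §6 p. 19 (second-moment display)] -/
def mainScale (q : ℕ) (Δ' : ℝ) : ℂ :=
  if hq : q = 0 then 0 else
    haveI : NeZero q := ⟨hq⟩
    2 * riemannZeta 2 ^ 2 * ((qhat q / (Δ' ^ 2 * Real.log (qhat q) ^ 2) : ℝ) : ℂ)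

/-- `ζ(2) q̂^{1/2}/(Δ' log q̂)`, the scale of the mollified first moment (prefactor of the first display
of §6 p. 19; junk value `0` at `q = 0`). [cite: KowalskiMichelVanderKam2000, §6 p. 19 (first-moment display)] -/
def linScale (q : ℕ) (Δ' : ℝ) : ℂ :=
  if hq : q = 0 then 0 else
    haveI : NeZero q := ⟨hq⟩
    riemannZeta 2 * ((Real.sqrt (qhat q) / (Δ' * Real.log (qhat q)) : ℝ) : ℂ)

/-- The RELATIVE defect of the mollified SECOND moment at level `q` (mollifier length `q̂^{Δ'}`) from
the DIAGONAL-ONLY main term `mainScale · secondMomentForm Δ' P Q` (junk value `0` at `q = 0`).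
[cite: KowalskiMichelVanderKam2000, §6 p. 19 (second-moment display)] -/
def secondDefect (P Q : ℝ[X]) (Δ' : ℝ) (q : ℕ) : ℝ :=
  if hq : q = 0 then 0 else
    haveI : NeZero q := ⟨hq⟩
    ‖QhPQ q P Q (qhat q ^ Δ') - mainScale q Δ' * ((secondMomentForm Δ' P Q : ℝ) : ℂ)‖ /
      ‖mainScale q Δ'‖

/-- The RELATIVE defect of the mollified FIRST moment at level `q` from the diagonal main term
`linScale · linForm Δ' P Q` (junk value `0` at `q = 0`).
[cite: KowalskiMichelVanderKam2000, §6 p. 19 (first-moment display)] -/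
def firstDefect (P Q : ℝ[X]) (Δ' : ℝ) (q : ℕ) : ℝ :=
  if hq : q = 0 then 0 else
    haveI : NeZero q := ⟨hq⟩
    ‖LhPQ q P Q (qhat q ^ Δ') - linScale q Δ' * ((linForm Δ' P Q : ℝ) : ℂ)‖ / ‖linScale q Δ'‖

open Classical in
/-- The «good primes» of a dyadic block: primes `q ∈ (N, 2N]` with `q̂(q)^{Δ'} ∉ ℕ` (KMV's proviso
`M ∉ ℤ`, the guard of `MomentAsymptotics`; `q̂ = √q/(2π)` spelled out, so no `NeZero` instance is
needed inside the filter). [cite: KowalskiMichelVanderKam2000, §2 p. 7 (M ∉ ℤ)] -/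
def goodPrimes (Δ' : ℝ) (N : ℕ) : Finset ℕ :=
  (Icc (N + 1) (2 * N)).filter (fun q => q.Prime ∧ ∀ n : ℕ, (n : ℝ) ≠ (Real.sqrt q / (2 * π)) ^ Δ')

/-- **`PrimeAveragedDiagOnly a b`** (the card's `C⁺`): on the window `(a, b)` the mollified first and
second harmonic moments are DIAGONAL-ONLY ON AVERAGE over the good primes of dyadic blocks, to
relative precision `o(1)` — for every admissible `P`, even-or-odd `Q`, `Δ' ∈ (a, b)`, `ε > 0`,
eventually in `N`: `Σ_{q ∈ goodPrimes Δ' N} (firstDefect + secondDefect) ≤ ε · #goodPrimes Δ' N`.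
A PREDICATE with parameters; NOT IN PRINT on any window reaching `Δ' ≥ 1` and (A)-sensitive per the
card — never asserted here. [cite: KowalskiMichelVanderKam2000, §6 p. 19 (shape of the two displays)] -/
def PrimeAveragedDiagOnly (a b : ℝ) : Prop :=
  ∀ P Q : ℝ[X], Admissible P → IsEvenOrOdd Q → ∀ Δ' : ℝ, a < Δ' → Δ' < b →
    ∀ ε : ℝ, 0 < ε → ∃ N₀ : ℕ, ∀ N : ℕ, N₀ ≤ N →
      ∑ q ∈ goodPrimes Δ' N, (firstDefect P Q Δ' q + secondDefect P Q Δ' q)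
        ≤ ε * (goodPrimes Δ' N).card

/-! ## Unfolding at a non-zero level; non-negativity -/

/-- `secondDefect` at a non-zero level, with `mainScale` unfolded. [cite: KowalskiMichelVanderKam2000, §6 p. 19] -/
theorem secondDefect_eq (P Q : ℝ[X]) (Δ' : ℝ) (q : ℕ) [NeZero q] :
    secondDefect P Q Δ' q =
      ‖QhPQ q P Q (qhat q ^ Δ') -
          2 * riemannZeta 2 ^ 2 * ((qhat q / (Δ' ^ 2 * Real.log (qhat q) ^ 2) : ℝ) : ℂ) *
            ((secondMomentForm Δ' P Q : ℝ) : ℂ)‖ /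
        ‖2 * riemannZeta 2 ^ 2 * ((qhat q / (Δ' ^ 2 * Real.log (qhat q) ^ 2) : ℝ) : ℂ)‖ := by
  unfold secondDefect mainScale
  rw [dif_neg (NeZero.ne q), dif_neg (NeZero.ne q)]

/-- `firstDefect` at a non-zero level, with `linScale` unfolded. [cite: KowalskiMichelVanderKam2000, §6 p. 19] -/
theorem firstDefect_eq (P Q : ℝ[X]) (Δ' : ℝ) (q : ℕ) [NeZero q] :
    firstDefect P Q Δ' q =
      ‖LhPQ q P Q (qhat q ^ Δ') -
          riemannZeta 2 * ((Real.sqrt (qhat q) / (Δ' * Real.log (qhat q)) : ℝ) : ℂ) *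
            ((linForm Δ' P Q : ℝ) : ℂ)‖ /
        ‖riemannZeta 2 * ((Real.sqrt (qhat q) / (Δ' * Real.log (qhat q)) : ℝ) : ℂ)‖ := by
  unfold firstDefect linScale
  rw [dif_neg (NeZero.ne q), dif_neg (NeZero.ne q)]

/-- The second defect is non-negative. [cite: KowalskiMichelVanderKam2000, §6 p. 19] -/
theorem secondDefect_nonneg (P Q : ℝ[X]) (Δ' : ℝ) (q : ℕ) : 0 ≤ secondDefect P Q Δ' q := by
  unfold secondDefect
  split_ifs
  · exact le_rfl
  · positivity

/-- The first defect is non-negative. [cite: KowalskiMichelVanderKam2000, §6 p. 19] -/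
theorem firstDefect_nonneg (P Q : ℝ[X]) (Δ' : ℝ) (q : ℕ) : 0 ≤ firstDefect P Q Δ' q := by
  unfold firstDefect
  split_ifs
  · exact le_rfl
  · positivity

/-! ## Good primes populate dyadic blocks -/

/-- Membership in `goodPrimes Δ' N`. [cite: KowalskiMichelVanderKam2000, §2 p. 7 (M ∉ ℤ)] -/
theorem mem_goodPrimes_iff {Δ' : ℝ} {N q : ℕ} :
    q ∈ goodPrimes Δ' N ↔
      N + 1 ≤ q ∧ q ≤ 2 * N ∧ q.Prime ∧ ∀ n : ℕ, (n : ℝ) ≠ (Real.sqrt q / (2 * π)) ^ Δ' := by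
  classical
  simp only [goodPrimes, mem_filter, mem_Icc, and_assoc]

/-- If good primes for `Δ'` are unbounded, blocks `(N, 2N]` holding a good prime exist for unboundedly
many `N` (a good prime `q` lies in the block of `N = q − 1`). [cite: KowalskiMichelVanderKam2000, §2 p. 7 (M ∉ ℤ)] -/
theorem exists_goodPrimes_nonempty {Δ' : ℝ} (h : GoodPrimesUnbounded Δ') (N₀ : ℕ) :
    ∃ N : ℕ, N₀ ≤ N ∧ (goodPrimes Δ' N).Nonempty := by
  obtain ⟨q, inst, hq, hqge, hgood⟩ := h (N₀ + 1)
  have h2 := hq.two_le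
  refine ⟨q - 1, by omega, q, mem_goodPrimes_iff.2 ⟨by omega, by omega, hq, fun n ↦ ?_⟩⟩
  simpa [qhat] using hgood n

/-! ## At a good prime the defect dominates `|T| − O(1/log q̂)` -/

/-- Core algebra: if `‖L − S·(m + t)‖ ≤ e` with `S ≠ 0`, then `|t| − e/‖S‖ ≤ ‖L − S·m‖/‖S‖`. [folklore] -/
private theorem abs_sub_div_le_of_norm_sub_le {L S : ℂ} {m t e : ℝ} (hS : 0 < ‖S‖)
    (h : ‖L - S * ((m + t : ℝ) : ℂ)‖ ≤ e) : |t| - e / ‖S‖ ≤ ‖L - S * ((m : ℝ) : ℂ)‖ / ‖S‖ := by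
  set E : ℂ := L - S * ((m + t : ℝ) : ℂ) with hE
  have hdec : L - S * ((m : ℝ) : ℂ) = E + S * ((t : ℝ) : ℂ) := by rw [hE]; push_cast; ring
  have hST : ‖S * ((t : ℝ) : ℂ)‖ = ‖S‖ * |t| := by rw [norm_mul, Complex.norm_real, Real.norm_eq_abs]
  have hlow : ‖S‖ * |t| - e ≤ ‖L - S * ((m : ℝ) : ℂ)‖ := by
    rw [hdec, ← hST]
    have e' : S * ((t : ℝ) : ℂ) = (E + S * ((t : ℝ) : ℂ)) - E := by ring
    have h' : ‖S * ((t : ℝ) : ℂ)‖ ≤ ‖E + S * ((t : ℝ) : ℂ)‖ + ‖E‖ := by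
      calc ‖S * ((t : ℝ) : ℂ)‖ = ‖(E + S * ((t : ℝ) : ℂ)) - E‖ := by rw [← e']
        _ ≤ ‖E + S * ((t : ℝ) : ℂ)‖ + ‖E‖ := norm_sub_le _ _
    linarith
  rw [le_div_iff₀ hS]
  have : (|t| - e / ‖S‖) * ‖S‖ = ‖S‖ * |t| - e := by field_simp
  rw [this]
  exact hlow

/-- Under `MomentAsymptotics Δlo Δhi T₁ T₂`: at every good prime `q` past a threshold, `1 ≤ log q̂(q)`
and `|T₂ Δ' P Q| − C/log q̂(q) ≤ secondDefect P Q Δ' q` (second display: `Q^h = mainScale·(second +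
T₂) + O(q̂ log⁻³ q̂)`, and `O(q̂ log⁻³ q̂)/‖mainScale‖ = O(1/log q̂)`).
[cite: KowalskiMichelVanderKam2000, §6 p. 19 (second-moment display)] -/
theorem abs_T₂_sub_le_secondDefect {Δlo Δhi : ℝ} {T₁ T₂ : ℝ → ℝ[X] → ℝ[X] → ℝ}
    (h : MomentAsymptotics Δlo Δhi T₁ T₂) {P Q : ℝ[X]} (hP : Admissible P) (hQ : IsEvenOrOdd Q)
    {Δ' : ℝ} (h1 : Δlo < Δ') (h2 : Δ' ≤ Δhi) (hΔ' : 0 < Δ') :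
    ∃ C : ℝ, 0 ≤ C ∧ ∃ q₀ : ℕ, ∀ (q : ℕ) [NeZero q], q.Prime → q₀ ≤ q →
      (∀ n : ℕ, (n : ℝ) ≠ qhat q ^ Δ') →
        1 ≤ Real.log (qhat q) ∧ |T₂ Δ' P Q| - C / Real.log (qhat q) ≤ secondDefect P Q Δ' q := by
  obtain ⟨C, q₀, hC⟩ := h P Q hP hQ Δ' h1 h2
  obtain ⟨N, hN⟩ := exists_log_qhat_ge 1
  have hz1 : riemannZeta 2 ≠ 0 := riemannZeta_ne_zero_of_one_le_re (by norm_num)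
  have hz : (2 * riemannZeta 2 ^ 2 : ℂ) ≠ 0 := mul_ne_zero two_ne_zero (pow_ne_zero 2 hz1)
  have hzpos : 0 < ‖(2 * riemannZeta 2 ^ 2 : ℂ)‖ := norm_pos_iff.2 hz
  refine ⟨|C| * Δ' ^ 2 / ‖(2 * riemannZeta 2 ^ 2 : ℂ)‖, by positivity, max q₀ N,
    fun q _ hq hq₀ hgood ↦ ?_⟩
  have hlg : 1 ≤ Real.log (qhat q) := hN q (le_trans (le_max_right _ _) hq₀)
  have hlgpos : 0 < Real.log (qhat q) := by linarith
  have hqhatpos : 0 < qhat q := by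
    have : 0 < (q : ℝ) := by exact_mod_cast hq.pos
    unfold qhat; positivity
  refine ⟨hlg, ?_⟩
  obtain ⟨-, b1⟩ := hC q hq (le_trans (le_max_left _ _) hq₀) hgood
  set r : ℝ := qhat q / (Δ' ^ 2 * Real.log (qhat q) ^ 2) with hr
  have hrpos : 0 < r := by rw [hr]; positivity
  set S : ℂ := 2 * riemannZeta 2 ^ 2 * ((r : ℝ) : ℂ) with hS
  have hSn : ‖S‖ = ‖(2 * riemannZeta 2 ^ 2 : ℂ)‖ * r := by
    rw [hS, norm_mul, Complex.norm_real, Real.norm_eq_abs, abs_of_pos hrpos]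
  have hSpos : 0 < ‖S‖ := by rw [hSn]; positivity
  have hEb : ‖QhPQ q P Q (qhat q ^ Δ') - S * ((secondMomentForm Δ' P Q + T₂ Δ' P Q : ℝ) : ℂ)‖ ≤
      |C| * qhat q * (Real.log (qhat q))⁻¹ ^ 3 := by
    refine b1.trans ?_
    have hs2 : 0 ≤ qhat q * (Real.log (qhat q))⁻¹ ^ 3 := by positivity
    rw [mul_assoc, mul_assoc]
    exact mul_le_mul_of_nonneg_right (le_abs_self C) hs2
  have hcore := abs_sub_div_le_of_norm_sub_le hSpos hEb
  -- the error relative to the scale is `≤ |C| Δ'² / (‖2ζ(2)²‖ log q̂)`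
  have hrel : |C| * qhat q * (Real.log (qhat q))⁻¹ ^ 3 / ‖S‖ ≤
      |C| * Δ' ^ 2 / ‖(2 * riemannZeta 2 ^ 2 : ℂ)‖ / Real.log (qhat q) := by
    rw [hSn, hr]
    refine le_of_eq ?_
    field_simp
  rw [secondDefect_eq]
  linarith

/-- Under `MomentAsymptotics Δlo Δhi T₁ T₂`: at every good prime `q` past a threshold, `1 ≤ log q̂(q)`
and `|T₁ Δ' P Q| − C/log q̂(q) ≤ firstDefect P Q Δ' q` (first display: error `O(q̂^{1/2} log⁻² q̂)`,
scale `ζ(2) q̂^{1/2}/(Δ' log q̂)`). [cite: KowalskiMichelVanderKam2000, §6 p. 19 (first-moment display)] -/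
theorem abs_T₁_sub_le_firstDefect {Δlo Δhi : ℝ} {T₁ T₂ : ℝ → ℝ[X] → ℝ[X] → ℝ}
    (h : MomentAsymptotics Δlo Δhi T₁ T₂) {P Q : ℝ[X]} (hP : Admissible P) (hQ : IsEvenOrOdd Q)
    {Δ' : ℝ} (h1 : Δlo < Δ') (h2 : Δ' ≤ Δhi) (hΔ' : 0 < Δ') :
    ∃ C : ℝ, 0 ≤ C ∧ ∃ q₀ : ℕ, ∀ (q : ℕ) [NeZero q], q.Prime → q₀ ≤ q →
      (∀ n : ℕ, (n : ℝ) ≠ qhat q ^ Δ') →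
        1 ≤ Real.log (qhat q) ∧ |T₁ Δ' P Q| - C / Real.log (qhat q) ≤ firstDefect P Q Δ' q := by
  obtain ⟨C, q₀, hC⟩ := h P Q hP hQ Δ' h1 h2
  obtain ⟨N, hN⟩ := exists_log_qhat_ge 1
  have hz : riemannZeta 2 ≠ 0 := riemannZeta_ne_zero_of_one_le_re (by norm_num)
  have hzpos : 0 < ‖riemannZeta 2‖ := norm_pos_iff.2 hz
  refine ⟨|C| * Δ' / ‖riemannZeta 2‖, by positivity, max q₀ N, fun q _ hq hq₀ hgood ↦ ?_⟩
  have hlg : 1 ≤ Real.log (qhat q) := hN q (le_trans (le_max_right _ _) hq₀)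
  have hlgpos : 0 < Real.log (qhat q) := by linarith
  have hqhatpos : 0 < qhat q := by
    have : 0 < (q : ℝ) := by exact_mod_cast hq.pos
    unfold qhat; positivity
  have hspos : 0 < Real.sqrt (qhat q) := Real.sqrt_pos.2 hqhatpos
  refine ⟨hlg, ?_⟩
  obtain ⟨b1, -⟩ := hC q hq (le_trans (le_max_left _ _) hq₀) hgood
  set r : ℝ := Real.sqrt (qhat q) / (Δ' * Real.log (qhat q)) with hr
  have hrpos : 0 < r := by rw [hr]; positivity
  set S : ℂ := riemannZeta 2 * ((r : ℝ) : ℂ) with hS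
  have hSn : ‖S‖ = ‖riemannZeta 2‖ * r := by
    rw [hS, norm_mul, Complex.norm_real, Real.norm_eq_abs, abs_of_pos hrpos]
  have hSpos : 0 < ‖S‖ := by rw [hSn]; positivity
  have hEb : ‖LhPQ q P Q (qhat q ^ Δ') - S * ((linForm Δ' P Q + T₁ Δ' P Q : ℝ) : ℂ)‖ ≤
      |C| * Real.sqrt (qhat q) * (Real.log (qhat q))⁻¹ ^ 2 := by
    refine b1.trans ?_
    have hs2 : 0 ≤ Real.sqrt (qhat q) * (Real.log (qhat q))⁻¹ ^ 2 := by positivity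
    rw [mul_assoc, mul_assoc]
    exact mul_le_mul_of_nonneg_right (le_abs_self C) hs2
  have hcore := abs_sub_div_le_of_norm_sub_le hSpos hEb
  have hrel : |C| * Real.sqrt (qhat q) * (Real.log (qhat q))⁻¹ ^ 2 / ‖S‖ ≤
      |C| * Δ' / ‖riemannZeta 2‖ / Real.log (qhat q) := by
    rw [hSn, hr]
    refine le_of_eq ?_
    field_simp
  rw [firstDefect_eq]
  linarith

/-! ## The squeeze: an `ε`-average over a non-empty block of good primes pins the extra main terms -/

/-- Abstract squeeze: if `F q ≥ |t| − C/log q̂(q)` (with `1 ≤ log q̂(q)`) at every good prime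
`q ≥ q₀` for `Δ'`, good primes for `Δ'` are unbounded, and the block sums of `F` over `goodPrimes Δ' N`
are eventually `≤ ε · #goodPrimes Δ' N` for every `ε > 0`, then `t = 0`. [folklore] -/
private theorem eq_zero_of_goodPrimes_average {Δ' t C : ℝ} {q₀ : ℕ} {F : ℕ → ℝ} (hC : 0 ≤ C)
    (hF : ∀ (q : ℕ) [NeZero q], q.Prime → q₀ ≤ q → (∀ n : ℕ, (n : ℝ) ≠ qhat q ^ Δ') →
      1 ≤ Real.log (qhat q) ∧ |t| - C / Real.log (qhat q) ≤ F q)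
    (hgood : GoodPrimesUnbounded Δ')
    (hav : ∀ ε : ℝ, 0 < ε → ∃ N₀ : ℕ, ∀ N : ℕ, N₀ ≤ N →
      ∑ q ∈ goodPrimes Δ' N, F q ≤ ε * (goodPrimes Δ' N).card) : t = 0 := by
  by_contra hne
  set δ : ℝ := |t| with hδ
  have hδpos : 0 < δ := abs_pos.2 hne
  obtain ⟨N₀, hN₀⟩ := hav (δ / 4) (by positivity)
  -- threshold beyond which `C / log q̂ ≤ δ/4`
  set B : ℝ := 4 * C / δ + 1 with hB
  obtain ⟨N₁, hN₁⟩ := exists_log_qhat_ge B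
  obtain ⟨N, hNge, hNne⟩ := exists_goodPrimes_nonempty hgood (max N₀ (max q₀ N₁))
  have hsum := hN₀ N (le_trans (le_max_left _ _) hNge)
  -- every good prime of the block contributes at least `3δ/4`
  have hterm : ∀ q ∈ goodPrimes Δ' N, 3 * δ / 4 ≤ F q := by
    intro q hq
    rw [mem_goodPrimes_iff] at hq
    obtain ⟨hqN, -, hqp, hqg⟩ := hq
    haveI : NeZero q := ⟨hqp.ne_zero⟩
    have hq₀ : q₀ ≤ q := by
      have := le_trans (le_max_left _ _) (le_trans (le_max_right _ _) hNge); omega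
    have hqN₁ : N₁ ≤ q := by
      have := le_trans (le_max_right _ _) (le_trans (le_max_right _ _) hNge); omega
    obtain ⟨hlg1, hle⟩ := hF q hqp hq₀ (fun n ↦ by simpa [qhat] using hqg n)
    have hlgB : B ≤ Real.log (qhat q) := hN₁ q hqN₁
    have hlgpos : 0 < Real.log (qhat q) := by linarith
    have hCle : C / Real.log (qhat q) ≤ δ / 4 := by
      rw [div_le_iff₀ hlgpos]
      have h4 : C ≤ δ / 4 * B := by
        have : δ / 4 * (4 * C / δ + 1) = C + δ / 4 := by field_simp
        rw [hB, this]
        linarith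
      exact h4.trans (mul_le_mul_of_nonneg_left hlgB (by positivity))
    linarith
  have hcard : (0 : ℝ) < (goodPrimes Δ' N).card := by exact_mod_cast hNne.card_pos
  have hlow : 3 * δ / 4 * (goodPrimes Δ' N).card ≤ ∑ q ∈ goodPrimes Δ' N, F q := by
    have := Finset.card_nsmul_le_sum (goodPrimes Δ' N) _ (3 * δ / 4) hterm
    rwa [nsmul_eq_mul, mul_comm] at this
  nlinarith [hlow.trans hsum]

/-- **The squeeze, second moment.** If the moment asymptotics hold on `(Δlo, Δhi]` with extra main
terms `(T₁, T₂)` and the moments are diagonal-only on average over the good primes of dyadic blocks on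
`(a, b)`, then `T₂ Δ' P Q = 0` at every `Δ' ∈ (Δlo, Δhi] ∩ (a, b) ∩ (0, 2]`.
[cite: KowalskiMichelVanderKam2000, §6 p. 19 (second-moment display)] -/
theorem T₂_eq_zero_of_primeAveragedDiagOnly {Δlo Δhi a b : ℝ} {T₁ T₂ : ℝ → ℝ[X] → ℝ[X] → ℝ}
    (h : MomentAsymptotics Δlo Δhi T₁ T₂) (hav : PrimeAveragedDiagOnly a b)
    {P Q : ℝ[X]} (hP : Admissible P) (hQ : IsEvenOrOdd Q) {Δ' : ℝ}
    (h1 : Δlo < Δ') (h2 : Δ' ≤ Δhi) (ha : a < Δ') (hb : Δ' < b) (hΔ' : 0 < Δ') (hΔ2 : Δ' ≤ 2) :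
    T₂ Δ' P Q = 0 := by
  have hgood : GoodPrimesUnbounded Δ' := by
    rcases eq_or_lt_of_le hΔ2 with rfl | hlt
    · exact goodPrimesUnbounded_two
    · exact goodPrimesUnbounded_of_lt_two hΔ' hlt
  obtain ⟨C, hC0, q₀, hC⟩ := abs_T₂_sub_le_secondDefect h hP hQ h1 h2 hΔ'
  refine eq_zero_of_goodPrimes_average (q₀ := q₀)
    (F := fun q ↦ firstDefect P Q Δ' q + secondDefect P Q Δ' q) hC0 (fun q _ hq hq₀ hg ↦ ?_) hgood
    (hav P Q hP hQ Δ' ha hb)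
  obtain ⟨hlg, hle⟩ := hC q hq hq₀ hg
  exact ⟨hlg, hle.trans (le_add_of_nonneg_left (firstDefect_nonneg P Q Δ' q))⟩

/-- **The squeeze, first moment.** Likewise `T₁ Δ' P Q = 0` at every `Δ' ∈ (Δlo, Δhi] ∩ (a, b) ∩ (0, 2]`.
[cite: KowalskiMichelVanderKam2000, §6 p. 19 (first-moment display)] -/
theorem T₁_eq_zero_of_primeAveragedDiagOnly {Δlo Δhi a b : ℝ} {T₁ T₂ : ℝ → ℝ[X] → ℝ[X] → ℝ}
    (h : MomentAsymptotics Δlo Δhi T₁ T₂) (hav : PrimeAveragedDiagOnly a b)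
    {P Q : ℝ[X]} (hP : Admissible P) (hQ : IsEvenOrOdd Q) {Δ' : ℝ}
    (h1 : Δlo < Δ') (h2 : Δ' ≤ Δhi) (ha : a < Δ') (hb : Δ' < b) (hΔ' : 0 < Δ') (hΔ2 : Δ' ≤ 2) :
    T₁ Δ' P Q = 0 := by
  have hgood : GoodPrimesUnbounded Δ' := by
    rcases eq_or_lt_of_le hΔ2 with rfl | hlt
    · exact goodPrimesUnbounded_two
    · exact goodPrimesUnbounded_of_lt_two hΔ' hlt
  obtain ⟨C, hC0, q₀, hC⟩ := abs_T₁_sub_le_firstDefect h hP hQ h1 h2 hΔ'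
  refine eq_zero_of_goodPrimes_average (q₀ := q₀)
    (F := fun q ↦ firstDefect P Q Δ' q + secondDefect P Q Δ' q) hC0 (fun q _ hq hq₀ hg ↦ ?_) hgood
    (hav P Q hP hQ Δ' ha hb)
  obtain ⟨hlg, hle⟩ := hC q hq hq₀ hg
  exact ⟨hlg, hle.trans (le_add_of_nonneg_right (secondDefect_nonneg P Q Δ' q))⟩

/-! ## The card's first lemma in the KMV vocabulary: `C⁺ ⇒ K_B` -/

/-- **First lemma of the card `good-primes-table-squeeze` (the squeeze gives the VALUE crux).** If the
moments are diagonal-only on average over the good primes of dyadic blocks on a window `(a, b)` with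
`a ≤ 1 < b`, then for EVERY window `(1, Δ]` and EVERY pair `(T₁, T₂)` consistent with
`MomentAsymptotics 1 Δ` there are `a' = 1 < b' = min Δ (min b 2) ≤ Δ`, `a' < 3/2`, and the admissible
profile `P = X²` whose Cauchy–Schwarz value `(lin + T₁)²/(2(second + T₂))` exceeds `¼` at every
`Δ' ∈ (a', b')` — the `(a, b)`-shape of the route's crux `BeyondDiagonalBeatsQuarter` (rev 1).
Mechanism: `T₁ = T₂ = 0` there by the squeeze, and the one-piece envelope `Δ'/(2(1+Δ'))` passes `¼`
exactly beyond the diagonal (`ratio_one_X_sq`, `quarter_lt_envelope'`). A REDUCTION: the hypothesis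
is NOT in print. [cite: KowalskiMichelVanderKam2000, Thm. 6.1 (32); §6 p. 19] -/
theorem beatsQuarter_ab_of_primeAveragedDiagOnly {a b : ℝ} (ha : a ≤ 1) (hb : 1 < b)
    (hav : PrimeAveragedDiagOnly a b) :
    ∀ Δ : ℝ, 1 < Δ → ∀ T₁ T₂ : ℝ → ℝ[X] → ℝ[X] → ℝ, MomentAsymptotics 1 Δ T₁ T₂ →
      ∃ a' b' : ℝ, 1 ≤ a' ∧ a' < b' ∧ b' ≤ Δ ∧ a' < 3 / 2 ∧ ∃ P : ℝ[X], Admissible P ∧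
        ∀ Δ' : ℝ, a' < Δ' → Δ' < b' →
          1 / 4 < (linForm Δ' P 1 + T₁ Δ' P 1) ^ 2 /
            (2 * (secondMomentForm Δ' P 1 + T₂ Δ' P 1)) := by
  intro Δ hΔ T₁ T₂ hMA
  refine ⟨1, min Δ (min b 2), le_rfl, lt_min hΔ (lt_min hb (by norm_num)), min_le_left _ _,
    by norm_num, X ^ 2, admissible_X_sq, fun Δ' h1 h2 ↦ ?_⟩
  have hΔ'Δ : Δ' ≤ Δ := h2.le.trans (min_le_left _ _)
  have hΔ'b : Δ' < b := lt_of_lt_of_le h2 ((min_le_right _ _).trans (min_le_left _ _))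
  have hΔ'2 : Δ' ≤ 2 := h2.le.trans ((min_le_right _ _).trans (min_le_right _ _))
  have hQ1 : IsEvenOrOdd (1 : ℝ[X]) := Or.inl fun x ↦ by simp
  have e1 : T₁ Δ' (X ^ 2) 1 = 0 :=
    T₁_eq_zero_of_primeAveragedDiagOnly hMA hav admissible_X_sq hQ1 h1 hΔ'Δ (lt_of_le_of_lt ha h1)
      hΔ'b (by linarith) hΔ'2
  have e2 : T₂ Δ' (X ^ 2) 1 = 0 :=
    T₂_eq_zero_of_primeAveragedDiagOnly hMA hav admissible_X_sq hQ1 h1 hΔ'Δ (lt_of_le_of_lt ha h1)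
      hΔ'b (by linarith) hΔ'2
  rw [e1, e2, add_zero, add_zero]
  have h := ratio_one_X_sq (Δ := Δ') (by linarith)
  unfold ratio at h
  rw [h]
  exact quarter_lt_envelope' h1

end Literature.NumberTheory.LFunctions.KMV2000
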